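import Summits.QuantumFields.GaugeBoot.SchwingerDysonPair
import Literature.MathematicalPhysics.QuantumLattice.RepLieAlgebraUnitary
import HarnessLib

/-!
# The single-link loop equation (Makeenko–Migdal / Schwinger–Dyson) for lattice `SU(N)` and `U(N)` (cell `gauge-boot`, L1, file 5/5)

Honest framing (cell rule): certified bounds on lattice expectations at stated coupling, gauge group, dimension and
torus size; NOT a mass gap, NOT a continuum limit, NOT a string tension; not summit-bearing
(`FixedCouplingUltralocality`, `PerturbativeInvisibility`).

This file CONTRACTS the pair identity of `SchwingerDysonPair.lean` over the matrix units: with the directions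
`X_ij = E_ij − (s/N)δ_ij·1` (`unitDir s i j`; `s = 1` for `𝔰𝔲`, `s = 0` for `𝔲`) and `Y = E_ji`, the sum over `(i, j)`
realises the completeness relation `Σ_a T^a ⊗ T^a` basis-free (`sum_trace_unitDir_sandwich`: `Σ_ij tr(E_ji A X_ij B)
= tr A tr B − (s/N) tr(AB)`; `sum_trace_mul_trace_unitDir`: `Σ_ij tr(E_ji C) tr(X_ij D) = tr(CD) − (s/N) tr C tr D`).
Result, for every edge `e = (x, μ)` of the torus `(ℤ/L)^d` (any `d`, `L ≥ 1`), every real `β` and every word `w`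
CLOSED at `x`:
`Σ_{k<|w|} E[splitTerm_k] + (β/2)·Σ_{ν≠μ} Σ_{ε=±} E[plaqTerm_{ν,ε}] = 0`            (`loopEquation_of_sdPair`)
where `splitTerm_k` is `tr ρ(hol w[0,k))·tr ρ(hol w[k,n)) − (s/N) tr ρ(hol w)` at a forward traversal of `e` by the
`k`-th letter, minus the analogous product at a backward one, and `plaqTerm_{ν,ε} = tr ρ(hol(w·P̃)) − tr ρ(hol(w·P̃⁻¹))
− (s/N) tr ρ(hol w)(tr ρ(hol P̃) − tr ρ(hol P̃⁻¹))` with `P̃ = P̃_{ν,ε}` the plaquette through `e` re-oriented to start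
with `e`.  Specialisations: `loopEquation_specialUnitaryGroup` (`G = SU(N)`, fundamental representation, `s = 1`;
admissibility from the tree's `mem_oneParamGenerators_specialUnitaryGroup`) and `loopEquation_unitaryGroup` (`s = 0`).
Dividing by `N²` (`W := tr/N`, `1/λ := β/(2N)`, `β = β_std/N`) gives exactly the row (MM) of the cell's
MM-DERIVATION.md §4 — Kazakov–Zheng's `A_id + A_split + A_join + A_var` equation (arXiv:2404.16925 (2.5)–(2.7)),
Guo–Li–Yang–Zhu's SDE (arXiv:2502.14421 §2.2), and (summed over marks) the finite-`N` master loop equation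
(Chatterjee, arXiv:1502.07719; Shen–Smith–Zhu, arXiv:2202.00880 Thm 1.1) — here as an unconditional theorem about
the finite torus.  Everything is `[folklore]` given the tree's Schwinger–Dyson identity.
-/

noncomputable section

open MeasureTheory Filter Topology NormedSpace
open scoped Matrix.Norms.Frobenius Matrix
open Literature.MathematicalPhysics.QuantumFieldTheory
open Summit.QuantumFields.YangMills.Cruxes.CurvatureAmnesia.WardDefect.SchwingerDyson

namespace Summit.QuantumFields.GaugeBoot

variable {d L N : ℕ} {G : Type} [Group G] {ρ : G →* Matrix (Fin N) (Fin N) ℂ}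

section Contraction

/-- The DIRECTION `E_ij − (s/N)δ_ij·1`: the matrix unit with (for `s = 1`) its trace part removed.  Summing
`X_ij ⊗ E_ji` over `(i, j)` realises the completeness relation `Σ_a T^a ⊗ T^a` of `𝔲(N)` (`s = 0`) resp. `𝔰𝔲(N)`
(`s = 1`) without choosing a basis of generators. [folklore] -/
def unitDir (s : ℂ) (i j : Fin N) : Matrix (Fin N) (Fin N) ℂ :=
  Matrix.single i j 1 - if i = j then (s / N) • (1 : Matrix (Fin N) (Fin N) ℂ) else 0

/-- `Σ_ij tr(E_ji A E_ij B) = tr A · tr B`. [folklore] -/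
theorem sum_trace_sandwich (A B : Matrix (Fin N) (Fin N) ℂ) :
    ∑ i : Fin N, ∑ j : Fin N, (Matrix.single j i (1 : ℂ) * A * Matrix.single i j 1 * B).trace =
      A.trace * B.trace := by
  simp only [Matrix.single_mul_mul_single, Matrix.trace_single_mul, one_mul, mul_one, smul_eq_mul]
  simp only [Matrix.trace, Matrix.diag_apply, Finset.sum_mul_sum]

/-- `Σ_i tr(E_ii M) = tr M`. [folklore] -/
theorem sum_trace_single_diag_mul (M : Matrix (Fin N) (Fin N) ℂ) :
    ∑ i : Fin N, (Matrix.single i i (1 : ℂ) * M).trace = M.trace := by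
  simp only [Matrix.trace_single_mul, one_smul]
  rfl

/-- `Σ_ij tr(E_ji C) tr(E_ij D) = tr(C D)`. [folklore] -/
theorem sum_trace_single_mul_trace_single_mul (C D : Matrix (Fin N) (Fin N) ℂ) :
    ∑ i : Fin N, ∑ j : Fin N, (Matrix.single j i (1 : ℂ) * C).trace * (Matrix.single i j (1 : ℂ) * D).trace =
      (C * D).trace := by
  simp only [Matrix.trace_single_mul, one_smul]
  simp only [Matrix.trace, Matrix.diag_apply, Matrix.mul_apply]

/-- **Split contraction**: `Σ_ij tr(E_ji · A · X_ij · B) = tr A · tr B − (s/N) tr(AB)`. [folklore] -/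
theorem sum_trace_unitDir_sandwich (s : ℂ) (A B : Matrix (Fin N) (Fin N) ℂ) :
    ∑ i : Fin N, ∑ j : Fin N, (Matrix.single j i (1 : ℂ) * A * unitDir s i j * B).trace =
      A.trace * B.trace - (s / N) * (A * B).trace := by
  have h : ∀ i j : Fin N, (Matrix.single j i (1 : ℂ) * A * unitDir s i j * B).trace =
      (Matrix.single j i (1 : ℂ) * A * Matrix.single i j 1 * B).trace -
        (if i = j then (s / N) * (Matrix.single i i (1 : ℂ) * (A * B)).trace else 0) := by
    intro i j
    unfold unitDir
    rw [Matrix.mul_sub, Matrix.sub_mul, Matrix.trace_sub]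
    congr 1
    split_ifs with hij
    · subst hij
      rw [Matrix.mul_smul, Matrix.mul_one, Matrix.smul_mul, Matrix.trace_smul, smul_eq_mul, Matrix.mul_assoc]
    · simp
  simp only [h, Finset.sum_sub_distrib, sum_trace_sandwich, Finset.sum_ite_eq, Finset.mem_univ, if_true,
    ← Finset.mul_sum, sum_trace_single_diag_mul]

/-- **Join contraction**: `Σ_ij tr(E_ji C) · tr(X_ij D) = tr(CD) − (s/N) tr C · tr D`. [folklore] -/
theorem sum_trace_mul_trace_unitDir (s : ℂ) (C D : Matrix (Fin N) (Fin N) ℂ) :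
    ∑ i : Fin N, ∑ j : Fin N, (Matrix.single j i (1 : ℂ) * C).trace * (unitDir s i j * D).trace =
      (C * D).trace - (s / N) * (C.trace * D.trace) := by
  have h : ∀ i j : Fin N, (Matrix.single j i (1 : ℂ) * C).trace * (unitDir s i j * D).trace =
      (Matrix.single j i (1 : ℂ) * C).trace * (Matrix.single i j (1 : ℂ) * D).trace -
        (if i = j then (s / N) * ((Matrix.single i i (1 : ℂ) * C).trace * D.trace) else 0) := by
    intro i j
    unfold unitDir
    rw [Matrix.sub_mul, Matrix.trace_sub, mul_sub]
    congr 1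
    split_ifs with hij
    · subst hij
      rw [Matrix.smul_mul, Matrix.one_mul, Matrix.trace_smul, smul_eq_mul]
      ring
    · simp
  simp only [h, Finset.sum_sub_distrib, sum_trace_single_mul_trace_single_mul, Finset.sum_ite_eq, Finset.mem_univ,
    if_true, ← Finset.mul_sum, ← Finset.sum_mul, sum_trace_single_diag_mul]

/-- For `s = 1` the directions `X_ij` are traceless (`𝔰𝔩_N`). [folklore] -/
theorem trace_unitDir_one (i j : Fin N) : (unitDir (1 : ℂ) i j).trace = 0 := by
  unfold unitDir
  have hN : (N : ℂ) ≠ 0 := Nat.cast_ne_zero.2 (Fin.pos i).ne'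
  rw [Matrix.trace_sub]
  split_ifs with hij
  · subst hij
    rw [Matrix.trace_single_eq_same, Matrix.trace_smul, Matrix.trace_one, Fintype.card_fin, smul_eq_mul,
      div_mul_cancel₀ _ hN, sub_self]
  · rw [Matrix.trace_single_eq_of_ne _ _ _ hij, Matrix.trace_zero, sub_zero]

/-- For `s = 0` the directions are the matrix units (`𝔤𝔩_N`). [folklore] -/
theorem unitDir_zero (i j : Fin N) : unitDir (0 : ℂ) i j = Matrix.single i j 1 := by
  unfold unitDir; simp

end Contraction

section SplitTerms

variable (ρ) in
/-- The `k`-th SPLIT TERM of the loop equation for the word `w` read from `x` and the edge `e = (x, μ)` (weight `s`):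
at a forward traversal of `e` by the `k`-th letter, `tr ρ(hol w[0,k)) · tr ρ(hol w[k,n)) − (s/N) tr ρ(hol w)`; at a
backward one, `−(tr ρ(hol w[0,k]) · tr ρ(hol w(k,n)) − (s/N) tr ρ(hol w))`; else `0` (KZ2024's `A_split`/`A_join`,
MM-DERIVATION §4). [folklore] -/
def splitTerm (s : ℂ) (x : Site d L) (μ : Fin d) (U : GaugeConfig d L G) (w : Word d) (k : ℕ) : ℂ :=
  match w[k]? with
  | none => 0
  | some st =>
    if st.edge (Word.siteAt x w k) = (x, μ) then
      (if st.isFwd then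
        (ρ (wordHolonomy U x (w.take k))).trace * (ρ (wordHolonomy U (Word.siteAt x w k) (w.drop k))).trace -
          (s / N) * (ρ (wordHolonomy U x w)).trace
      else
        -((ρ (wordHolonomy U x (w.take (k + 1)))).trace *
            (ρ (wordHolonomy U (Word.siteAt x w (k + 1)) (w.drop (k + 1)))).trace -
          (s / N) * (ρ (wordHolonomy U x w)).trace))
    else 0

/-- Contracting the occurrence terms over the matrix units gives the split term. [folklore] -/
theorem sum_occTerm_unitDir (s : ℂ) (x : Site d L) (μ : Fin d) (U : GaugeConfig d L G) (w : Word d) (k : ℕ) :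
    ∑ i : Fin N, ∑ j : Fin N, occTerm ρ (x, μ) (unitDir s i j) (Matrix.single j i 1) U x w k =
      splitTerm ρ s x μ U w k := by
  unfold occTerm splitTerm
  cases w[k]? with
  | none => simp
  | some st =>
    simp only
    split_ifs
    · rw [sum_trace_unitDir_sandwich, ← map_mul, wordHolonomy_take_drop]
    · simp only [Finset.sum_neg_distrib, sum_trace_unitDir_sandwich, ← map_mul, wordHolonomy_take_drop]
    · simp

end SplitTerms

section Assembly

/-- A closed word followed by another word: holonomies multiply at the common base point. [folklore] -/
theorem wordHolonomy_append_closed (U : GaugeConfig d L G) (x : Site d L) (w v : Word d)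
    (hw : Word.endpoint x w = x) : wordHolonomy U x (w ++ v) = wordHolonomy U x w * wordHolonomy U x v := by
  rw [wordHolonomy_append, hw]

/-- Four-fold sum swap `Σ_i Σ_j Σ_ν Σ_ε = Σ_ν Σ_ε Σ_i Σ_j`. [folklore] -/
theorem sum₄_comm {ι κ α γ : Type*} (S₁ : Finset ι) (S₂ : Finset κ) (T₁ : Finset α) (T₂ : Finset γ)
    (f : ι → κ → α → γ → ℂ) :
    ∑ i ∈ S₁, ∑ j ∈ S₂, ∑ ν ∈ T₁, ∑ ε ∈ T₂, f i j ν ε = ∑ ν ∈ T₁, ∑ ε ∈ T₂, ∑ i ∈ S₁, ∑ j ∈ S₂, f i j ν ε := by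
  calc ∑ i ∈ S₁, ∑ j ∈ S₂, ∑ ν ∈ T₁, ∑ ε ∈ T₂, f i j ν ε
      = ∑ i ∈ S₁, ∑ ν ∈ T₁, ∑ j ∈ S₂, ∑ ε ∈ T₂, f i j ν ε :=
        Finset.sum_congr rfl fun _ _ => Finset.sum_comm
    _ = ∑ ν ∈ T₁, ∑ i ∈ S₁, ∑ j ∈ S₂, ∑ ε ∈ T₂, f i j ν ε := Finset.sum_comm
    _ = ∑ ν ∈ T₁, ∑ i ∈ S₁, ∑ ε ∈ T₂, ∑ j ∈ S₂, f i j ν ε :=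
        Finset.sum_congr rfl fun _ _ => Finset.sum_congr rfl fun _ _ => Finset.sum_comm
    _ = ∑ ν ∈ T₁, ∑ ε ∈ T₂, ∑ i ∈ S₁, ∑ j ∈ S₂, f i j ν ε :=
        Finset.sum_congr rfl fun _ _ => Finset.sum_comm

/-- **Contracted left side, pointwise**: `Σ_ij tr(E_ji · insDeriv_{X_ij} hol_w) = Σ_k splitTerm_k`. [folklore] -/
theorem sum_trace_insDeriv_unitDir (s : ℂ) (x : Site d L) (μ : Fin d) (U : GaugeConfig d L G) (w : Word d) :
    ∑ i : Fin N, ∑ j : Fin N, (Matrix.single j i (1 : ℂ) * insDeriv ρ (x, μ) (unitDir s i j) U x w).trace =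
      ∑ k ∈ Finset.range w.length, splitTerm ρ s x μ U w k := by
  simp only [trace_mul_insDeriv]
  calc ∑ i : Fin N, ∑ j : Fin N, ∑ k ∈ Finset.range w.length,
        occTerm ρ (x, μ) (unitDir s i j) (Matrix.single j i 1) U x w k
      = ∑ i : Fin N, ∑ k ∈ Finset.range w.length, ∑ j : Fin N,
          occTerm ρ (x, μ) (unitDir s i j) (Matrix.single j i 1) U x w k :=
        Finset.sum_congr rfl fun _ _ => Finset.sum_comm
    _ = ∑ k ∈ Finset.range w.length, ∑ i : Fin N, ∑ j : Fin N,
          occTerm ρ (x, μ) (unitDir s i j) (Matrix.single j i 1) U x w k := Finset.sum_comm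
    _ = ∑ k ∈ Finset.range w.length, splitTerm ρ s x μ U w k :=
        Finset.sum_congr rfl fun k _ => sum_occTerm_unitDir s x μ U w k

variable (ρ) in
/-- The PLAQUETTE TERM of the loop equation for `(ν, ε)`: `tr ρ(hol(w·P̃)) − tr ρ(hol(w·P̃⁻¹)) − (s/N)·tr ρ(hol w)·(tr ρ(hol P̃)
− tr ρ(hol P̃⁻¹))` with `P̃ = plaqWord μ ν ε` (KZ2024's `A_var` and the `s/λ` double-trace line; MM-DERIVATION §4). [folklore] -/
def plaqTerm (s : ℂ) (x : Site d L) (μ : Fin d) (U : GaugeConfig d L G) (w : Word d) (ν : Fin d) (ε : Bool) : ℂ :=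
  (ρ (wordHolonomy U x (w ++ plaqWord μ ν ε))).trace - (ρ (wordHolonomy U x (w ++ (plaqWord μ ν ε).reverse))).trace -
    (s / N) * ((ρ (wordHolonomy U x w)).trace *
      ((ρ (wordHolonomy U x (plaqWord μ ν ε))).trace - (ρ (wordHolonomy U x (plaqWord μ ν ε).reverse)).trace))

/-- **Contracted right side, pointwise**: `Σ_ij tr(E_ji ρ(hol_w))·(−½ plaqIns_{X_ij}) = −½ Σ_{ν≠μ,ε} plaqTerm_{ν,ε}`
(for a word closed at the source `x` of the edge). [folklore] -/
theorem sum_trace_mul_plaqIns_unitDir (s : ℂ) (x : Site d L) (μ : Fin d) (U : GaugeConfig d L G) (w : Word d)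
    (hw : Word.endpoint x w = x) :
    ∑ i : Fin N, ∑ j : Fin N, (Matrix.single j i (1 : ℂ) * ρ (wordHolonomy U x w)).trace *
        (-(1 / 2) * plaqIns ρ (unitDir s i j) U x μ) =
      -(1 / 2) * ∑ ν ∈ Finset.univ.erase μ, ∑ ε : Bool, plaqTerm ρ s x μ U w ν ε := by
  unfold plaqIns
  simp only [Finset.mul_sum]
  rw [sum₄_comm]
  refine Finset.sum_congr rfl fun ν _ => Finset.sum_congr rfl fun ε _ => ?_
  calc ∑ i : Fin N, ∑ j : Fin N, (Matrix.single j i (1 : ℂ) * ρ (wordHolonomy U x w)).trace *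
        (-(1 / 2) * (unitDir s i j * (ρ (wordHolonomy U x (plaqWord μ ν ε)) -
          ρ (wordHolonomy U x (plaqWord μ ν ε).reverse))).trace)
      = -(1 / 2) * ∑ i : Fin N, ∑ j : Fin N, (Matrix.single j i (1 : ℂ) * ρ (wordHolonomy U x w)).trace *
          (unitDir s i j * (ρ (wordHolonomy U x (plaqWord μ ν ε)) -
            ρ (wordHolonomy U x (plaqWord μ ν ε).reverse))).trace := by
        simp only [Finset.mul_sum]
        exact Finset.sum_congr rfl fun i _ => Finset.sum_congr rfl fun j _ => by ring
    _ = -(1 / 2) * plaqTerm ρ s x μ U w ν ε := by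
        rw [sum_trace_mul_trace_unitDir, plaqTerm, Matrix.mul_sub, Matrix.trace_sub, Matrix.trace_sub, ← map_mul,
          ← map_mul, ← wordHolonomy_append_closed U x w _ hw, ← wordHolonomy_append_closed U x w _ hw]

variable [TopologicalSpace G] [IsTopologicalGroup G] (r : LatticeRep G)

/-- Continuity of `U ↦ tr ρ(hol_w U)`. [folklore] -/
theorem continuous_trace_wordHolonomy (x : Site d L) (w : Word d) :
    Continuous fun U : GaugeConfig d L G => (r.ρ (wordHolonomy U x w)).trace :=
  (r.continuous.comp (continuous_wordHolonomy x w)).matrix_trace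

/-- Continuity of the split terms. [folklore] -/
theorem continuous_splitTerm (s : ℂ) (x : Site d L) (μ : Fin d) (w : Word d) (k : ℕ) :
    Continuous fun U : GaugeConfig d L G => splitTerm r.ρ s x μ U w k := by
  unfold splitTerm
  cases w[k]? with
  | none => exact continuous_const
  | some st =>
    simp only
    split_ifs
    · exact ((continuous_trace_wordHolonomy r x _).mul (continuous_trace_wordHolonomy r _ _)).sub
        (continuous_const.mul (continuous_trace_wordHolonomy r x w))
    · exact (((continuous_trace_wordHolonomy r x _).mul (continuous_trace_wordHolonomy r _ _)).sub
        (continuous_const.mul (continuous_trace_wordHolonomy r x w))).neg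
    · exact continuous_const

/-- Continuity of the plaquette terms. [folklore] -/
theorem continuous_plaqTerm (s : ℂ) (x : Site d L) (μ : Fin d) (w : Word d) (ν : Fin d) (ε : Bool) :
    Continuous fun U : GaugeConfig d L G => plaqTerm r.ρ s x μ U w ν ε := by
  unfold plaqTerm
  exact ((continuous_trace_wordHolonomy r x _).sub (continuous_trace_wordHolonomy r x _)).sub
    (continuous_const.mul ((continuous_trace_wordHolonomy r x w).mul
      ((continuous_trace_wordHolonomy r x _).sub (continuous_trace_wordHolonomy r x _))))

variable [CompactSpace G] [MeasurableSpace G] [BorelSpace G]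

/-- **THE SINGLE-LINK LOOP EQUATION (abstract form).**  Let `G` be compact with lattice representation `r`, `β` real,
`e = (x, μ)` an edge of the torus `(ℤ/L)^d`, `w` a word CLOSED at `x`, and `s ∈ ℂ` a weight such that every direction
`X_ij = E_ij − (s/N)δ_ij·1` satisfies the pair identity (`s = 1`: every traceless skew-Hermitian matrix generates a
one-parameter subgroup of `r.ρ(G)`, e.g. `G = SU(N)`; `s = 0`: every skew-Hermitian one, e.g. `G = U(N)`).  Then
`Σ_k E[splitTerm_k] + (β/2)·Σ_{ν≠μ} Σ_{ε=±} E[plaqTerm_{ν,ε}] = 0`,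
i.e. (dividing by `N²`, `W := tr/N`, `λ := 2N/β = 2N²/β_std`) the normal form (MM) of the cell's MM-DERIVATION.md §4:
`Σ_f (E[W_A W_B] − s E[W_w]/N²) − Σ_b (…) + (1/λ)Σ_P (E[W_{w·P}] − E[W_{w·P⁻¹}] − s·E[W_w(W_P − W_{P⁻¹})]) = 0`.
[folklore] -/
theorem loopEquation_of_sdPair [NeZero L] (β : ℝ) (x : Site d L) (μ : Fin d) (s : ℂ) (w : Word d)
    (hw : Word.endpoint x w = x) (hP : ∀ i j : Fin r.N, SDPair r β x μ x w (unitDir s i j)) :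
    (∑ k ∈ Finset.range w.length, ∫ U, splitTerm r.ρ s x μ U w k ∂(wilsonMeasure (d := d) (L := L) r.ρ β)) +
      (β / 2 : ℂ) * ∑ ν ∈ Finset.univ.erase μ, ∑ ε : Bool,
        ∫ U, plaqTerm r.ρ s x μ U w ν ε ∂(wilsonMeasure (d := d) (L := L) r.ρ β) = 0 := by
  set μW := wilsonMeasure (d := d) (L := L) r.ρ β with hμW
  have hf : ∀ i j : Fin r.N, Integrable
      (fun U => (Matrix.single j i (1 : ℂ) * insDeriv r.ρ (x, μ) (unitDir s i j) U x w).trace) μW :=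
    fun i j => integrable_of_continuous r β (continuous_trace_mul_insDeriv r _ _ (x, μ) x w)
  have hg : ∀ i j : Fin r.N, Integrable (fun U => (Matrix.single j i (1 : ℂ) * r.ρ (wordHolonomy U x w)).trace *
      (-(1 / 2) * plaqIns r.ρ (unitDir s i j) U x μ)) μW :=
    fun i j => integrable_of_continuous r β (continuous_rhsIntegrand r _ _ x μ x w)
  have h1 : ∫ U, ∑ k ∈ Finset.range w.length, splitTerm r.ρ s x μ U w k ∂μW =
      (β : ℂ) * ∫ U, -(1 / 2) * ∑ ν ∈ Finset.univ.erase μ, ∑ ε : Bool, plaqTerm r.ρ s x μ U w ν ε ∂μW := by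
    calc ∫ U, ∑ k ∈ Finset.range w.length, splitTerm r.ρ s x μ U w k ∂μW
        = ∫ U, ∑ i : Fin r.N, ∑ j : Fin r.N,
            (Matrix.single j i (1 : ℂ) * insDeriv r.ρ (x, μ) (unitDir s i j) U x w).trace ∂μW :=
          integral_congr_ae (ae_of_all _ fun U => (sum_trace_insDeriv_unitDir s x μ U w).symm)
      _ = ∑ i : Fin r.N, ∑ j : Fin r.N,
            ∫ U, (Matrix.single j i (1 : ℂ) * insDeriv r.ρ (x, μ) (unitDir s i j) U x w).trace ∂μW := by
          rw [integral_finsetSum _ fun i _ => integrable_finsetSum _ fun j _ => hf i j]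
          exact Finset.sum_congr rfl fun i _ => integral_finsetSum _ fun j _ => hf i j
      _ = ∑ i : Fin r.N, ∑ j : Fin r.N, (β : ℂ) * ∫ U, (Matrix.single j i (1 : ℂ) * r.ρ (wordHolonomy U x w)).trace *
            (-(1 / 2) * plaqIns r.ρ (unitDir s i j) U x μ) ∂μW :=
          Finset.sum_congr rfl fun i _ => Finset.sum_congr rfl fun j _ => hP i j (Matrix.single j i 1)
      _ = (β : ℂ) * ∑ i : Fin r.N, ∑ j : Fin r.N, ∫ U, (Matrix.single j i (1 : ℂ) * r.ρ (wordHolonomy U x w)).trace *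
            (-(1 / 2) * plaqIns r.ρ (unitDir s i j) U x μ) ∂μW := by
          simp only [Finset.mul_sum]
      _ = (β : ℂ) * ∫ U, ∑ i : Fin r.N, ∑ j : Fin r.N, (Matrix.single j i (1 : ℂ) * r.ρ (wordHolonomy U x w)).trace *
            (-(1 / 2) * plaqIns r.ρ (unitDir s i j) U x μ) ∂μW := by
          rw [integral_finsetSum _ fun i _ => integrable_finsetSum _ fun j _ => hg i j]
          congr 1
          exact (Finset.sum_congr rfl fun i _ => integral_finsetSum _ fun j _ => hg i j).symm
      _ = (β : ℂ) * ∫ U, -(1 / 2) * ∑ ν ∈ Finset.univ.erase μ, ∑ ε : Bool, plaqTerm r.ρ s x μ U w ν ε ∂μW := by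
          congr 1
          exact integral_congr_ae (ae_of_all _ fun U => sum_trace_mul_plaqIns_unitDir s x μ U w hw)
  have h2 : ∫ U, ∑ k ∈ Finset.range w.length, splitTerm r.ρ s x μ U w k ∂μW =
      ∑ k ∈ Finset.range w.length, ∫ U, splitTerm r.ρ s x μ U w k ∂μW :=
    integral_finsetSum _ fun k _ => integrable_of_continuous r β (continuous_splitTerm r s x μ w k)
  have h3 : ∫ U, -(1 / 2) * ∑ ν ∈ Finset.univ.erase μ, ∑ ε : Bool, plaqTerm r.ρ s x μ U w ν ε ∂μW =
      -(1 / 2) * ∑ ν ∈ Finset.univ.erase μ, ∑ ε : Bool, ∫ U, plaqTerm r.ρ s x μ U w ν ε ∂μW := by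
    rw [integral_const_mul]
    congr 1
    rw [integral_finsetSum _ fun ν _ => integrable_finsetSum _ fun ε _ =>
      integrable_of_continuous r β (continuous_plaqTerm r s x μ w ν ε)]
    exact Finset.sum_congr rfl fun ν _ => integral_finsetSum _ fun ε _ =>
      integrable_of_continuous r β (continuous_plaqTerm r s x μ w ν ε)
  rw [← h2, h1, h3]
  ring

end Assembly

section Concrete

open Literature.MathematicalPhysics.QuantumLattice

/-- **`SU(N)`: every traceless direction satisfies the pair identity** — a traceless skew-Hermitian `X` generates the
one-parameter subgroup `t ↦ exp(tX)` of `SU(N)` (tree `mem_oneParamGenerators_specialUnitaryGroup`, Hall Prop. 3.24),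
then polarisation. [folklore] -/
theorem sdPair_specialUnitaryGroup [NeZero L] (N : ℕ) (β : ℝ) (x : Site d L) (μ : Fin d) (x₀ : Site d L)
    (w : Word d) (X : Matrix (Fin N) (Fin N) ℂ) (hX : X.trace = 0) :
    SDPair (fundamentalLatticeRep N) β x μ x₀ w X := by
  refine sdPair_of_traceless (fundamentalLatticeRep N) β x μ x₀ w (fun X hXs hX0 => ?_) X hX
  have hmem := mem_oneParamGenerators_specialUnitaryGroup (n := Fin N) (X := X) hXs hX0
  refine sdPair_of_oneParam (fundamentalLatticeRep N) β x μ x₀ w hXs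
    (k := fun t => ⟨NormedSpace.exp (t • X), hmem t⟩) (fun a b => Subtype.ext ?_) (fun t => ?_)
  · change NormedSpace.exp ((a + b) • X) = NormedSpace.exp (a • X) * NormedSpace.exp (b • X)
    rw [add_smul]
    exact Matrix.exp_add_of_commute _ _ (((Commute.refl X).smul_left a).smul_right b)
  · change NormedSpace.exp (t • X) = NormedSpace.exp ((t : ℂ) • X)
    rw [Complex.coe_smul]

/-- **`U(N)`: every direction satisfies the pair identity** — a skew-Hermitian `X` generates the one-parameter subgroup
`t ↦ exp(tX)` of `U(N)` (tree `mem_oneParamGenerators_unitaryGroup`), then polarisation. [folklore] -/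
theorem sdPair_unitaryGroup [NeZero L] (N : ℕ) (β : ℝ) (x : Site d L) (μ : Fin d) (x₀ : Site d L) (w : Word d)
    (X : Matrix (Fin N) (Fin N) ℂ) : SDPair (unitaryFundamentalLatticeRep N) β x μ x₀ w X := by
  refine sdPair_of_skew (unitaryFundamentalLatticeRep N) β x μ x₀ w (fun X hXs => ?_) X
  have hmem := mem_oneParamGenerators_unitaryGroup (n := Fin N) (X := X) hXs
  refine sdPair_of_oneParam (unitaryFundamentalLatticeRep N) β x μ x₀ w hXs
    (k := fun t => ⟨NormedSpace.exp (t • X), hmem t⟩) (fun a b => Subtype.ext ?_) (fun t => ?_)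
  · change NormedSpace.exp ((a + b) • X) = NormedSpace.exp (a • X) * NormedSpace.exp (b • X)
    rw [add_smul]
    exact Matrix.exp_add_of_commute _ _ (((Commute.refl X).smul_left a).smul_right b)
  · change NormedSpace.exp (t • X) = NormedSpace.exp ((t : ℂ) • X)
    rw [Complex.coe_smul]

/-- **THE SINGLE-LINK LOOP EQUATION FOR LATTICE `SU(N)` YANG–MILLS** (Wilson action, torus `(ℤ/L)^d`, any `d, L ≥ 1`,
any real `β`; `s = 1`).  For every edge `e = (x, μ)` and every lattice word `w` closed at `x`:
`Σ_k E[splitTerm_k] + (β/2)·Σ_{ν≠μ,ε=±} E[plaqTerm_{ν,ε}] = 0`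
with `E` the expectation in Wilson's measure `wilsonMeasure (fundamentalRep) β` (`β = β_tree = β_std/N`).
Dividing by `N²` this is the row (MM) of the cell's MM-DERIVATION.md §4 with `s = 1`, `1/λ = β/(2N)`:
`(1 − (1+n_f−n_b)/N²)E[W_w] + Σ_f E[W W] − Σ_b E[W W] + (1/λ)Σ_P (E[W_{wP}] − E[W_{wP⁻¹}] − E[W_w(W_P − W_{P⁻¹})]) = 0`
— Kazakov–Zheng (2.5)–(2.7)/(1eq), Guo–Li–Yang–Zhu's SDE, the finite-`N` master loop equation of Chatterjee /
Shen–Smith–Zhu summed over marks.  Unconditional: a theorem about the finite torus. [folklore] -/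
theorem loopEquation_specialUnitaryGroup [NeZero L] (N : ℕ) (β : ℝ) (x : Site d L) (μ : Fin d) (w : Word d)
    (hw : Word.endpoint x w = x) :
    (∑ k ∈ Finset.range w.length, ∫ U, splitTerm (fundamentalRep (Fin N)) 1 x μ U w k
        ∂(wilsonMeasure (d := d) (L := L) (fundamentalRep (Fin N)) β)) +
      (β / 2 : ℂ) * ∑ ν ∈ Finset.univ.erase μ, ∑ ε : Bool,
        ∫ U, plaqTerm (fundamentalRep (Fin N)) 1 x μ U w ν ε
          ∂(wilsonMeasure (d := d) (L := L) (fundamentalRep (Fin N)) β) = 0 :=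
  loopEquation_of_sdPair (fundamentalLatticeRep N) β x μ 1 w hw
    fun i j => sdPair_specialUnitaryGroup N β x μ x w _ (trace_unitDir_one i j)

/-- **THE SINGLE-LINK LOOP EQUATION FOR LATTICE `U(N)`** (`s = 0`: no `1/N²` and no double-trace plaquette terms —
the rows are `N`-free, whence Kazakov–Zheng's "uniform in `N`" `U(N)` bounds). [folklore] -/
theorem loopEquation_unitaryGroup [NeZero L] (N : ℕ) (β : ℝ) (x : Site d L) (μ : Fin d) (w : Word d)
    (hw : Word.endpoint x w = x) :
    (∑ k ∈ Finset.range w.length, ∫ U, splitTerm (unitaryFundamentalRep (Fin N) ℂ) 0 x μ U w k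
        ∂(wilsonMeasure (d := d) (L := L) (unitaryFundamentalRep (Fin N) ℂ) β)) +
      (β / 2 : ℂ) * ∑ ν ∈ Finset.univ.erase μ, ∑ ε : Bool,
        ∫ U, plaqTerm (unitaryFundamentalRep (Fin N) ℂ) 0 x μ U w ν ε
          ∂(wilsonMeasure (d := d) (L := L) (unitaryFundamentalRep (Fin N) ℂ) β) = 0 :=
  loopEquation_of_sdPair (unitaryFundamentalLatticeRep N) β x μ 0 w hw
    fun _ _ => sdPair_unitaryGroup N β x μ x w _

end Concrete

end Summit.QuantumFields.GaugeBoot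

end
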